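import Mathlib.RingTheory.Flat.Basic
import Mathlib.LinearAlgebra.TensorProduct.RightExactness
import HarnessLib

/-!
# Flat modules in short exact sequences (Stacks Project, Tags 00HL and 00HM (2))

Two standard facts about a short exact sequence `0 → N′ —f→ N —g→ N″ → 0` of modules over a
commutative ring `R` that Mathlib (pin v4.32) lacks — it has "`M` flat ⇒ `M ⊗ −` exact"
(`Module.Flat.lTensor_exact`, `Module.Flat.lTensor_preserves_injective_linearMap`) but nothing in
which the flat module sits *inside* the sequence:

* `rTensor_injective_of_exact_of_flat` / `lTensor_injective_of_exact_of_flat` — **Tag 00HL**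
  (Stacks Project, Lemma 10.39.12: "Suppose that `R` is a ring, `0 → M″ → M′ → M → 0` a short
  exact sequence, and `N` an `R`-module. If `M` is flat then `N ⊗_R M″ → N ⊗_R M′` is injective,
  i.e., the sequence `0 → N ⊗_R M″ → N ⊗_R M′ → N ⊗_R M → 0` is a short exact sequence"): if
  `N″` is flat then `N′ ⊗ M → N ⊗ M` is injective for every `M` (Matsumura, *Commutative Ring
  Theory*, Appendix to §7, Example 1: `N′` is a *pure* submodule of `N`). PROVED by the printed
  diagram chase: present `M` as a quotient `K ↪ F ↠ M` of a free module `F`; the rows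
  `N′ ⊗ K → N ⊗ K → N″ ⊗ K → 0`, `0 → N′ ⊗ F → N ⊗ F → N″ ⊗ F` are exact (`F` is flat), the
  columns `(−) ⊗ K → (−) ⊗ F → (−) ⊗ M → 0` are exact, and `N″ ⊗ K → N″ ⊗ F` is injective
  (`N″` flat); an element of `Ker(N′ ⊗ M → N ⊗ M)` then chases to `0` (the snake lemma of the
  printed proof, done by hand).
* `flat_of_exact_of_flat_of_flat` — **Tag 00HM (2)** (Stacks Project, Lemma 10.39.13 (2):
  "Suppose that `0 → M′ → M → M″ → 0` is a short exact sequence of `R`-modules. [...] (2) If `M`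
  and `M″` are flat, then `M′` is flat"): PROVED from Tag 00HL — for `u : M₁ → M₂` injective,
  `N′ ⊗ M₁ → N ⊗ M₁ → N ⊗ M₂` is injective and equals `N′ ⊗ M₁ → N′ ⊗ M₂ → N ⊗ M₂`.

Both are the input of "a bounded above complex of flat modules is K-flat" (Görtz–Wedhorn II,
Lemma 21.93; Mumford, *Abelian Varieties*, §5, Lemma 2), used for the base change of the
Grothendieck complex (`Literature/AlgebraicGeometry/Motives/GrothendieckComplexH0Projective`).
Hypotheses are stated unbundled (`Function.Exact f g`, `f` injective, `g` surjective) as in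
Mathlib's `lTensor_exact`. Mathlib searched (pin): `Module.Flat.lTensor_exact`,
`Module.Flat.rTensor_preserves_injective_linearMap`, `lTensor_exact`, `rTensor_exact`,
`LinearMap.lTensor_surjective`, `LinearMap.rTensor_comp_lTensor`, `LinearMap.lTensor_comp_rTensor`,
`Finsupp.linearCombination_id_surjective`, `LinearMap.exact_subtype_ker_map`,
`Module.Flat.iff_rTensor_preserves_injective_linearMap` (all used); `CategoryTheory.Monoidal.Tor`
defines `Tor` abstractly but nothing connects it to `Module.Flat`.

## References

* The Stacks Project, Tag 00HL (Algebra, Lemma 10.39.12) and Tag 00HM (Algebra, Lemma 10.39.13).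
  [StacksProject]
* H. Matsumura, *Commutative Ring Theory*, Cambridge Studies in Advanced Mathematics 8 (1986/1989),
  §7, Thm. 7.9 and Appendix to §7 (pure submodules), Example 1. [Matsumura1987]
* U. Görtz, T. Wedhorn, *Algebraic Geometry II*, Springer Spektrum (2023), Lemma 21.93, p. 274.
  [GortzWedhorn2023]
-/

universe u v v₁ v₂ v₃ w

open TensorProduct

namespace Literature.RingTheory.Flat

variable {R : Type u} [CommRing R] {N' : Type v₁} {N : Type v₂} {N'' : Type v₃}
  [AddCommGroup N'] [Module R N'] [AddCommGroup N] [Module R N] [AddCommGroup N''] [Module R N'']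
  {f : N' →ₗ[R] N} {g : N →ₗ[R] N''}

/-- The diagram chase of Stacks Project, Tag 00HL through a given flat presentation
`K —i→ F —p→ M → 0` of `M` (`F` flat, `i` injective onto `Ker p`): if `0 → N′ —f→ N —g→ N″ → 0`
is exact and `N″` is flat then `f ⊗ M` is injective. [cite: StacksProject, Tag 00HL (Algebra, Lemma 10.39.12), proof] -/
theorem rTensor_injective_of_exact_of_flat_of_presentation [Module.Flat R N'']
    (hfg : Function.Exact f g) (hf : Function.Injective f) (hg : Function.Surjective g)
    {K : Type*} {F : Type*} {M : Type*} [AddCommGroup K] [Module R K] [AddCommGroup F]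
    [Module R F] [AddCommGroup M] [Module R M] [Module.Flat R F] {i : K →ₗ[R] F} {p : F →ₗ[R] M}
    (hip : Function.Exact i p) (hi : Function.Injective i) (hp : Function.Surjective p) :
    Function.Injective (f.rTensor M) := by
  have hpi : p ∘ₗ i = 0 := hip.linearMap_comp_eq_zero
  have a₂_inj : Function.Injective (f.rTensor F) :=
    Module.Flat.rTensor_preserves_injective_linearMap f hf
  have γ_inj : Function.Injective (i.lTensor N'') :=
    Module.Flat.lTensor_preserves_injective_linearMap i hi
  rw [← LinearMap.ker_eq_bot, Submodule.eq_bot_iff]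
  intro x hx
  rw [LinearMap.mem_ker] at hx
  obtain ⟨x', rfl⟩ := LinearMap.lTensor_surjective N' hp x
  -- `(f ⊗ F) x'` dies in `N ⊗ M`, hence comes from `N ⊗ K`
  have h1 : p.lTensor N (f.rTensor F x') = 0 := by
    rw [← LinearMap.comp_apply, LinearMap.lTensor_comp_rTensor, ← LinearMap.rTensor_comp_lTensor,
      LinearMap.comp_apply, hx]
  obtain ⟨y, hy⟩ := (lTensor_exact N hip hp _).1 h1
  -- `(g ⊗ K) y` dies in `N″ ⊗ F`, hence is `0` (`N″` flat), hence `y` comes from `N′ ⊗ K`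
  have h2 : i.lTensor N'' (g.rTensor K y) = 0 := by
    rw [← LinearMap.comp_apply, LinearMap.lTensor_comp_rTensor, ← LinearMap.rTensor_comp_lTensor,
      LinearMap.comp_apply, hy, ← LinearMap.comp_apply, ← LinearMap.rTensor_comp,
      hfg.linearMap_comp_eq_zero, LinearMap.rTensor_zero, LinearMap.zero_apply]
  have h3 : g.rTensor K y = 0 := γ_inj (by rw [h2, map_zero])
  obtain ⟨z, rfl⟩ := ((rTensor_exact K hfg hg) y).1 h3
  -- so `x'` comes from `N′ ⊗ K` and `x = (N′ ⊗ p) x' = 0`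
  have h4 : f.rTensor F x' = f.rTensor F (i.lTensor N' z) := by
    rw [← hy, ← LinearMap.comp_apply, ← LinearMap.comp_apply, LinearMap.lTensor_comp_rTensor,
      LinearMap.rTensor_comp_lTensor]
  have h5 : x' = i.lTensor N' z := a₂_inj h4
  rw [h5, ← LinearMap.comp_apply, ← LinearMap.lTensor_comp, hpi, LinearMap.lTensor_zero,
    LinearMap.zero_apply]

/-- **Stacks Project, Tag 00HL** (Lemma 10.39.12): if `0 → N′ —f→ N —g→ N″ → 0` is exact and `N″`
is flat, then `f ⊗ M : N′ ⊗ M → N ⊗ M` is injective for every `R`-module `M` (so that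
`0 → N′ ⊗ M → N ⊗ M → N″ ⊗ M → 0` is again exact). Proof by the printed diagram chase through the
free presentation `Ker p ↪ R^{(M)} —p↠ M`. [cite: StacksProject, Tag 00HL (Algebra, Lemma 10.39.12)] -/
theorem rTensor_injective_of_exact_of_flat [Module.Flat R N''] (hfg : Function.Exact f g)
    (hf : Function.Injective f) (hg : Function.Surjective g)
    (M : Type w) [AddCommGroup M] [Module R M] :
    Function.Injective (f.rTensor M) :=
  rTensor_injective_of_exact_of_flat_of_presentation hfg hf hg
    (LinearMap.exact_subtype_ker_map (Finsupp.linearCombination R (id : M → M)))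
    (LinearMap.ker _).injective_subtype (Finsupp.linearCombination_id_surjective R M)

/-- **Stacks Project, Tag 00HL**, left-handed form: if `0 → N′ —f→ N —g→ N″ → 0` is exact and
`N″` is flat, then `M ⊗ f : M ⊗ N′ → M ⊗ N` is injective for every `R`-module `M`.
[cite: StacksProject, Tag 00HL (Algebra, Lemma 10.39.12)] -/
theorem lTensor_injective_of_exact_of_flat [Module.Flat R N''] (hfg : Function.Exact f g)
    (hf : Function.Injective f) (hg : Function.Surjective g)
    (M : Type w) [AddCommGroup M] [Module R M] :
    Function.Injective (f.lTensor M) := by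
  have h := rTensor_injective_of_exact_of_flat hfg hf hg M
  have e : f.lTensor M = (TensorProduct.comm R N M).toLinearMap ∘ₗ f.rTensor M ∘ₗ
      (TensorProduct.comm R M N').toLinearMap := by
    ext m x
    simp
  rw [e]
  exact (TensorProduct.comm R N M).injective.comp (h.comp (TensorProduct.comm R M N').injective)

/-- **Stacks Project, Tag 00HL**, full statement: if `0 → N′ → N → N″ → 0` is exact with `N″`
flat, then `0 → N′ ⊗ M → N ⊗ M → N″ ⊗ M → 0` is exact for every `M` (injective on the left,
exact in the middle, surjective on the right). [cite: StacksProject, Tag 00HL (Algebra, Lemma 10.39.12)] -/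
theorem rTensor_shortExact_of_flat [Module.Flat R N''] (hfg : Function.Exact f g)
    (hf : Function.Injective f) (hg : Function.Surjective g)
    (M : Type w) [AddCommGroup M] [Module R M] :
    Function.Injective (f.rTensor M) ∧ Function.Exact (f.rTensor M) (g.rTensor M) ∧
      Function.Surjective (g.rTensor M) :=
  ⟨rTensor_injective_of_exact_of_flat hfg hf hg M, rTensor_exact M hfg hg,
    LinearMap.rTensor_surjective M hg⟩

/-- **Stacks Project, Tag 00HM (2)** (Lemma 10.39.13 (2)): if `0 → N′ —f→ N —g→ N″ → 0` is
exact and `N`, `N″` are flat, then `N′` is flat — for `u : M₁ → M₂` injective the composite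
`N′ ⊗ M₁ → N ⊗ M₁ → N ⊗ M₂` is injective (Tag 00HL and flatness of `N`) and equals
`N′ ⊗ M₁ → N′ ⊗ M₂ → N ⊗ M₂`. [cite: StacksProject, Tag 00HM (Algebra, Lemma 10.39.13 (2))] -/
theorem flat_of_exact_of_flat_of_flat [Module.Flat R N] [Module.Flat R N'']
    (hfg : Function.Exact f g) (hf : Function.Injective f) (hg : Function.Surjective g) :
    Module.Flat R N' := by
  rw [Module.Flat.iff_lTensor_preserves_injective_linearMap]
  intro M₁ M₂ _ _ _ _ u hu
  -- `(f ⊗ M₂) ∘ (N′ ⊗ u) = (N ⊗ u) ∘ (f ⊗ M₁)` is injective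
  have h1 : Function.Injective (f.rTensor M₁) := rTensor_injective_of_exact_of_flat hfg hf hg M₁
  have h2 : Function.Injective (u.lTensor N) := Module.Flat.lTensor_preserves_injective_linearMap u hu
  have e : f.rTensor M₂ ∘ₗ u.lTensor N' = u.lTensor N ∘ₗ f.rTensor M₁ := by
    rw [LinearMap.rTensor_comp_lTensor, LinearMap.lTensor_comp_rTensor]
  have h3 : Function.Injective (f.rTensor M₂ ∘ₗ u.lTensor N') := by
    rw [e]
    exact h2.comp h1
  exact Function.Injective.of_comp h3

end Literature.RingTheory.Flat
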